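import Summits.HodgeConjecture.HodgeConjecture.Theorems.PadicSemiregularLiftFormalVectorBundlesAlgebraizeFormallyFreeCokernelSections
import Summits.HodgeConjecture.HodgeConjecture.Theorems.PadicSemiregularLiftFormalVectorBundlesAlgebraizeFormallyFreeCokernelAlgebra
import Summits.HodgeConjecture.HodgeConjecture.Theorems.PadicSemiregularLiftFormalVectorBundlesAlgebraizeFormallyFreeCokernelUnitBaseChange
import Summits.HodgeConjecture.HodgeConjecture.Theses.PadicSemiregularLift
import Summits.HodgeConjecture.HodgeConjecture.Theorems.FormalLiftingFromClassLifting.Negative.VectorBundleConverse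
import Literature.AlgebraicGeometry.KTheory.PullbackVectorBundle
import Mathlib.AlgebraicGeometry.Morphisms.UniversallyClosed
import Mathlib.Algebra.Category.ModuleCat.Kernels
import Mathlib.CategoryTheory.Limits.Preserves.Shapes.Kernels
import Mathlib.RingTheory.Localization.Free
import Mathlib.AlgebraicGeometry.Noetherian
import Mathlib.Algebra.Module.FinitePresentation
import HarnessLib

/-!
# Formally free cokernel (stub ED of `FormalVectorBundlesAlgebraize`, line `chow-zariski-pushforward`)

Closes the registered stub `stub_formallyFreeCokernel` of the crux
`PadicSemiregularLift.FormalVectorBundlesAlgebraize` (stmt-HodgeConjecture-14106): for `Z` proper over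
`W = W(k)` and `u : V' → V` a morphism of vector bundles on `Z`, if `G = coker u` restricts to a vector
bundle on every thickening `Z_{n+1} = Z ×_W Spec W/p^{n+1}`, then `G` is a vector bundle
(Görtz–Wedhorn, *Algebraic Geometry II*, Prop. 24.95 with Lemma 24.96). Proof (namespace `FFC`): near
`x ∈ Z` over the closed point of `Spec W` take an affine open `U = Spec R` with `V ≅ 𝒪^I`, `V' ≅ 𝒪^J`,
so `G|_{Spec R} ≅ Ñ₀`, `N₀ = R^I/im(R^J)`; `Spec R/π^{n+1}` (`π` the image of `p`) factors through
`Z_{n+1}`, so the pull-back of `Ñ₀` to it is finite locally free with flat global sections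
`R/π^{n+1} ⊗_R N₀`; by the algebra core (`exists_free_localizedModule_of_flat_quotient_powers`)
`N₀[1/r]` is free for some `r ∉ 𝔮_x`, so `G` is free on `D(r)`; the free locus is an open containing
the special fibre, hence everything, `Z → Spec W` being closed (GW II, Lemma 24.96).
Everything is proved; no definitions.
-/

-- `Summit.HodgeConjecture.HodgeConjecture.…` repeats the summit name by the D-0017 layout (Sub = Summit).
set_option linter.dupNamespace false

noncomputable section

universe u

open CategoryTheory CategoryTheory.Limits AlgebraicGeometry Opposite TopologicalSpace
open Literature.AlgebraicGeometry.Motives Literature.AlgebraicGeometry.Motives.WittScheme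
open Literature.AlgebraicGeometry.KTheory
open Summit.HodgeConjecture.HodgeConjecture.Theorems.FormalLiftingFromClassLifting.Negative
  (isFiniteLocallyFree_of_isVectorBundle)

namespace Summit.HodgeConjecture.HodgeConjecture.Theorems.FormalVectorBundlesAlgebraize

namespace FFC

variable {R : CommRingCat.{u}}

set_option backward.isDefEq.respectTransparency false in
/-- `𝒪^I` restricts to `𝒪^I` along an open immersion. -/
theorem nonempty_restrict_free_iso {X Y : Scheme.{u}} (f : X ⟶ Y) [IsOpenImmersion f] (I : Type u) :
    Nonempty ((Scheme.Modules.restrictFunctor f).obj (SheafOfModules.free I) ≅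
      SheafOfModules.free I) :=
  haveI : PreservesColimitsOfSize.{u, u} (Scheme.Modules.restrictFunctor f) := inferInstance
  ⟨(SheafOfModules.mapFreeIso (Scheme.Modules.restrictFunctor f) I
    (Scheme.Modules.restrictUnitIso f).symm).symm⟩

set_option backward.isDefEq.respectTransparency false in
/-- On `Spec R`, the cokernel of a morphism `𝒪^J → 𝒪^I` is `Ñ` for `N = R^I / im(R^J)`. -/
theorem exists_tilde_iso_cokernel {I J : Type u}
    (v : (SheafOfModules.free J : (Spec R).Modules) ⟶ SheafOfModules.free I) :
    ∃ φ₀ : ModuleCat.of R (J →₀ (R : Type u)) ⟶ ModuleCat.of R (I →₀ (R : Type u)),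
      Nonempty (cokernel v ≅
        tilde (ModuleCat.of R ((I →₀ (R : Type u)) ⧸ LinearMap.range φ₀.hom))) := by
  let φ₀ : ModuleCat.of R (J →₀ (R : Type u)) ⟶ ModuleCat.of R (I →₀ (R : Type u)) :=
    (tilde.functor R).preimage ((tildeFinsupp J).hom ≫ v ≫ (tildeFinsupp I).inv)
  have hφ₀ : (tilde.functor R).map φ₀ = (tildeFinsupp J).hom ≫ v ≫ (tildeFinsupp I).inv :=
    (tilde.functor R).map_preimage _
  refine ⟨φ₀, ⟨?_⟩⟩
  let e₁ : cokernel v ≅ cokernel ((tilde.functor R).map φ₀) :=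
    cokernel.mapIso v ((tilde.functor R).map φ₀) (tildeFinsupp J).symm (tildeFinsupp I).symm (by
      rw [hφ₀]
      simp)
  let e₂ : (tilde.functor R).obj (cokernel φ₀) ≅ cokernel ((tilde.functor R).map φ₀) :=
    PreservesCokernel.iso (tilde.functor R) φ₀
  exact e₁ ≪≫ e₂.symm ≪≫ (tilde.functor R).mapIso (ModuleCat.cokernelIsoRangeQuotient φ₀)

attribute [local instance] RingHomInvPair.of_ringEquiv in
/-- Freeness of `N[1/r]` does not depend on the model of the localisation. -/
theorem free_iff_of_isLocalizedModule_powers {A : Type u} [CommRing A] (r : A)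
    {N : Type u} [AddCommGroup N] [Module A N]
    (Aᵣ : Type u) [CommRing Aᵣ] [Algebra A Aᵣ] [IsLocalization.Away r Aᵣ]
    (Nᵣ : Type u) [AddCommGroup Nᵣ] [Module A Nᵣ] (f : N →ₗ[A] Nᵣ)
    [IsLocalizedModule (Submonoid.powers r) f] [Module Aᵣ Nᵣ] [IsScalarTower A Aᵣ Nᵣ] :
    Module.Free (Localization.Away r) (LocalizedModule.Away r N) ↔ Module.Free Aᵣ Nᵣ := by
  set e := (IsLocalization.algEquiv (Submonoid.powers r) (Localization.Away r) Aᵣ).toRingEquiv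
  apply Module.Free.iff_of_equiv (σ := (e : Localization.Away r →+* Aᵣ))
  refine { __ := IsLocalizedModule.iso (Submonoid.powers r) f, map_smul' := ?_ }
  intro a x
  obtain ⟨a, s, rfl⟩ := IsLocalization.exists_mk'_eq (Submonoid.powers r) a
  apply ((Module.End.isUnit_iff _).mp (IsLocalizedModule.map_units f s)).1
  simp [e, ← map_smul, ← smul_assoc]

/-- **Free on a basic open.** If `N₀[1/r]` is a finite free `R[1/r]`-module then the restriction of
`Ñ₀` along `Spec R[1/r] → Spec R` is `𝒪^I` with `I` finite. -/
theorem exists_free_iso_restrict_away {Rr : CommRingCat.{u}} [Algebra R Rr] (r : R)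
    [IsLocalization.Away r Rr]
    [IsOpenImmersion (Spec.map (CommRingCat.ofHom (algebraMap R Rr) : R ⟶ Rr))]
    (N₀ : ModuleCat.{u} R) [Module.Finite R N₀]
    (hfree : Module.Free (Localization.Away r) (LocalizedModule.Away r N₀)) :
    ∃ (I : Type u) (_ : Finite I), Nonempty (SheafOfModules.free I ≅
      (Scheme.Modules.restrictFunctor
        (Spec.map (CommRingCat.ofHom (algebraMap R Rr) : R ⟶ Rr))).obj (tilde N₀)) := by
  let loc : R ⟶ Rr := CommRingCat.ofHom (algebraMap R Rr)
  let j := Spec.map loc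
  let T := (Scheme.Modules.restrictFunctor j).obj (tilde N₀)
  have hU : j ''ᵁ ⊤ = PrimeSpectrum.basicOpen r := by
    rw [Scheme.Hom.image_top_eq_opensRange]
    ext1
    exact PrimeSpectrum.localization_away_comap_range Rr r
  let F := (modulesSpecToSheaf.obj (tilde N₀)).obj
  let f₀ := tilde.toOpen N₀ (j ''ᵁ ⊤)
  have hf₀ : tilde.toOpen N₀ (PrimeSpectrum.basicOpen r) ≫ F.map (eqToHom hU).op = f₀ :=
    tilde.toOpen_res N₀ _ _ (eqToHom hU)
  have hloc : IsLocalizedModule (Submonoid.powers r) f₀.hom := by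
    rw [← hf₀, ModuleCat.hom_comp]
    exact IsLocalizedModule.of_linearEquiv (Submonoid.powers r)
      (tilde.toOpen N₀ (PrimeSpectrum.basicOpen r)).hom
      (F.mapIso (eqToIso hU).op).toLinearEquiv
  letI : Module R Γ(T, ⊤) := (inferInstance : Module R (F.obj (op (j ''ᵁ ⊤))))
  haveI : IsScalarTower R Rr Γ(T, ⊤) := IsScalarTower.of_algebraMap_smul fun b t =>
    Scheme.Modules.restrictAppIso_smul_Spec (M := tilde N₀) loc b t
  let f : N₀ →ₗ[R] Γ(T, ⊤) := f₀.hom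
  haveI : IsLocalizedModule (Submonoid.powers r) f := hloc
  haveI : Module.Free Rr Γ(T, ⊤) :=
    (free_iff_of_isLocalizedModule_powers (A := R) r Rr Γ(T, ⊤) f).mp hfree
  haveI : Module.Finite Rr Γ(T, ⊤) := Module.Finite.of_isLocalizedModule (Submonoid.powers r) f
  exact exists_free_iso_of_free_sections T

/-- If every point of `X` is in the image of an open immersion along which `E` restricts to a
finite free module, then `E` is finite locally free. -/
theorem isFiniteLocallyFree_of_openImmersion_charts {X : Scheme.{u}} {E : X.Modules}
    (h : ∀ x : X, ∃ (Y : Scheme.{u}) (j : Y ⟶ X) (_ : IsOpenImmersion j), x ∈ Set.range j ∧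
      ∃ I : Type u, Finite I ∧
        Nonempty (SheafOfModules.free I ≅ (Scheme.Modules.restrictFunctor j).obj E)) :
    IsFiniteLocallyFree E := by
  refine isFiniteLocallyFree_of_restrict fun x => ?_
  obtain ⟨Y, j, hj, hx, I, hI, ⟨e⟩⟩ := h x
  let U : X.Opens := j.opensRange
  have hrange : Set.range j = Set.range U.ι := by
    rw [Scheme.Opens.range_ι]
    rfl
  let ε : Y ≅ ↑U := IsOpenImmersion.isoOfRangeEq j U.ι hrange
  have hε : ε.inv ≫ j = U.ι := IsOpenImmersion.isoOfRangeEq_inv_fac _ _ _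
  obtain ⟨eF⟩ := nonempty_restrict_free_iso ε.inv I
  refine ⟨U, hx, I, hI, ⟨?_⟩⟩
  exact eF.symm ≪≫ (Scheme.Modules.restrictFunctor ε.inv).mapIso e ≪≫
    ((Scheme.Modules.restrictFunctorComp ε.inv j).app E).symm ≪≫
    (Scheme.Modules.restrictFunctorCongr hε).app E

/-- **Görtz–Wedhorn II, Lemma 24.96**: if `f : X → Y` is closed and every point of `Y` specialises
to `s`, an open of `X` containing the fibre over `s` is all of `X`. -/
theorem opens_eq_top_of_isClosedMap {X Y : Scheme.{u}} (f : X ⟶ Y) (hf : IsClosedMap f)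
    (s : Y) (hs : ∀ y : Y, y ⤳ s) (U : X.Opens) (hU : ∀ x : X, f x = s → x ∈ U) : U = ⊤ := by
  rw [eq_top_iff]
  rintro x -
  by_contra hx
  have hC : IsClosed ((U : Set X)ᶜ) := U.isOpen.isClosed_compl
  have hfC : IsClosed (f '' (U : Set X)ᶜ) := hf _ hC
  obtain ⟨c, hc, hcs⟩ := (hs (f x)).mem_closed hfC ⟨x, hx, rfl⟩
  exact hc (hU c hcs)

/-- A trivialisation over an affine `U` trivialises the restriction along `Spec Γ(X, U) → X`. -/
theorem nonempty_free_iso_restrict_fromSpec {X : Scheme.{u}} {E : X.Modules} {U : X.Opens} (hU : IsAffineOpen U)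
    {I : Type u} (e : SheafOfModules.free I ≅ E.over U) :
    Nonempty (SheafOfModules.free I ≅ (Scheme.Modules.restrictFunctor hU.fromSpec).obj E) := by
  obtain ⟨e₁⟩ := nonempty_restrictIso_of_overIso e
  obtain ⟨eF⟩ := nonempty_restrict_free_iso hU.isoSpec.inv I
  exact ⟨eF.symm ≪≫ (Scheme.Modules.restrictFunctor hU.isoSpec.inv).mapIso e₁ ≪≫
    ((Scheme.Modules.restrictFunctorComp hU.isoSpec.inv U.ι).app E).symm⟩

/-- Two finite locally free modules are both trivial on `Spec` of some affine open around a point. -/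
theorem exists_affine_trivialisations {X : Scheme.{u}} {V V' : X.Modules} (hV : IsFiniteLocallyFree V)
    (hV' : IsFiniteLocallyFree V') (x : X) :
    ∃ (U : X.Opens) (hU : IsAffineOpen U), x ∈ U ∧ ∃ (I J : Type u), Finite I ∧ Finite J ∧
      Nonempty (SheafOfModules.free I ≅ (Scheme.Modules.restrictFunctor hU.fromSpec).obj V) ∧
      Nonempty (SheafOfModules.free J ≅ (Scheme.Modules.restrictFunctor hU.fromSpec).obj V') := by
  obtain ⟨U₁, hx₁, I, hI, ⟨e₁⟩⟩ := hV x
  obtain ⟨U₂, hx₂, J, hJ, ⟨e₂⟩⟩ := hV' x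
  obtain ⟨U, hU, hxU, hle⟩ := Opens.isBasis_iff_nbhd.mp X.isBasis_affineOpens
    (show x ∈ U₁ ⊓ U₂ from ⟨hx₁, hx₂⟩)
  refine ⟨U, hU, hxU, I, J, hI, hJ, ?_, ?_⟩
  · exact nonempty_free_iso_restrict_fromSpec hU
      (SheafOfModules.restrictTrivialisation (R := X.ringCatSheaf)
        (homOfLE (hle.trans inf_le_left)) e₁)
  · exact nonempty_free_iso_restrict_fromSpec hU
      (SheafOfModules.restrictTrivialisation (R := X.ringCatSheaf)
        (homOfLE (hle.trans inf_le_right)) e₂)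

set_option backward.isDefEq.respectTransparency false in
/-- On the `Spec` of an affine open where `V ≅ 𝒪^I` and `V' ≅ 𝒪^J`, the restriction of
`coker (u : V' → V)` is `Ñ₀` for `N₀ = R^I / im(R^J)`. -/
theorem exists_tilde_iso_restrict_cokernel {X : Scheme.{u}} {V V' : X.Modules} (u : V' ⟶ V) {U : X.Opens}
    (hU : IsAffineOpen U) {I J : Type u}
    (eV : SheafOfModules.free I ≅ (Scheme.Modules.restrictFunctor hU.fromSpec).obj V)
    (eV' : SheafOfModules.free J ≅ (Scheme.Modules.restrictFunctor hU.fromSpec).obj V') :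
    ∃ φ₀ : ModuleCat.of Γ(X, U) (J →₀ (Γ(X, U) : Type u)) ⟶ ModuleCat.of Γ(X, U) (I →₀ (Γ(X, U) : Type u)),
      Nonempty ((Scheme.Modules.restrictFunctor hU.fromSpec).obj (cokernel u) ≅
        tilde (ModuleCat.of Γ(X, U) ((I →₀ (Γ(X, U) : Type u)) ⧸ LinearMap.range φ₀.hom))) := by
  let F := Scheme.Modules.restrictFunctor hU.fromSpec
  haveI : PreservesColimitsOfSize.{u, u} F := inferInstance
  let uR : (SheafOfModules.free J : (Spec Γ(X, U)).Modules) ⟶ SheafOfModules.free I :=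
    eV'.hom ≫ F.map u ≫ eV.inv
  obtain ⟨φ₀, ⟨e⟩⟩ := exists_tilde_iso_cokernel uR
  refine ⟨φ₀, ⟨?_ ≪≫ e⟩⟩
  exact PreservesCokernel.iso F u ≪≫ cokernel.mapIso (F.map u) uR eV'.symm eV.symm (by simp [uR])

section Thickening

open TensorProduct

variable {p : ℕ} [Fact p.Prime] {k : Type u} [CommRing k] (Z : SchemeOver (WittVector p k))

/-- **Chart of a thickening.** For `ρ : Spec R → 𝒳` with `ρ ≫ 𝒳.hom = Spec τ` and `π = τ(p)`,
`Spec R/π^{n+1} → Spec R → 𝒳` factors through the thickening `X_{n+1} = 𝒳 ×_W Spec W_{n+1} → 𝒳`. -/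
theorem exists_lift_thickening {R : CommRingCat.{u}} (ρ : Spec R ⟶ Z.left)
    (τ : CommRingCat.of (WittVector p k) ⟶ R) (hτ : Spec.map τ = ρ ≫ Z.hom) (n : ℕ) :
    ∃ θ : Spec (CommRingCat.of (R ⧸ Ideal.span {τ.hom (p : WittVector p k)} ^ (n + 1))) ⟶
        (thickening Z (n + 1)).left,
      θ ≫ thickeningι Z (n + 1) =
        Spec.map (CommRingCat.ofHom (algebraMap R (R ⧸ Ideal.span {τ.hom (p : WittVector p k)} ^ (n + 1))) :
          R ⟶ CommRingCat.of (R ⧸ Ideal.span {τ.hom (p : WittVector p k)} ^ (n + 1))) ≫ ρ := by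
  set Iq : Ideal R := Ideal.span {τ.hom (p : WittVector p k)} ^ (n + 1) with hIq
  have hle : Ideal.span {(p : WittVector p k)} ^ (n + 1) ≤ Iq.comap τ.hom := by
    rw [← Ideal.map_le_iff_le_comap, Ideal.map_pow, Ideal.map_span, Set.image_singleton]
  let ψ : wittQuot p k (n + 1) →+* R ⧸ Iq := Ideal.quotientMap Iq τ.hom hle
  let g : R ⟶ CommRingCat.of (R ⧸ Iq) := CommRingCat.ofHom (algebraMap R (R ⧸ Iq))
  have w : (Spec.map g ≫ ρ) ≫ Z.hom = Spec.map (CommRingCat.ofHom ψ) ≫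
      Spec.map (CommRingCat.ofHom (algebraMap (WittVector p k) (wittQuot p k (n + 1)))) := by
    rw [Category.assoc, ← hτ, ← Spec.map_comp, ← Spec.map_comp]
    rfl
  refine ⟨pullback.lift (Spec.map g ≫ ρ) (Spec.map (CommRingCat.ofHom ψ)) w, ?_⟩
  exact pullback.lift_fst _ _ _
/-- `Module.Flat` transports along linear equivalences (instance arguments unified, not synthesised). -/
theorem flat_of_linearEquiv' {A : Type*} {M N : Type*} {_ : CommSemiring A} {_ : AddCommMonoid M}
    {_ : Module A M} {_ : AddCommMonoid N} {_ : Module A N} (h : Module.Flat A M) (e : N ≃ₗ[A] M) :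
    Module.Flat A N :=
  Module.Flat.of_linearEquiv e

set_option backward.isDefEq.respectTransparency false in
/-- **The truncations are flat.** With `ρ`, `τ`, `π = τ(p)` as above and `G|_{Spec R} ≅ Ñ₀`: if
`G|_{X_{n+1}}` is a vector bundle then `R/π^{n+1} ⊗_R N₀` (the global sections of the pull-back of
`Ñ₀` to `Spec R/π^{n+1}`, a finite locally free module) is flat over `R/π^{n+1}`. -/
theorem flat_quotient_pow_of_isVectorBundle_pullback {R : CommRingCat.{u}} (ρ : Spec R ⟶ Z.left)
    [IsOpenImmersion ρ]
    (τ : CommRingCat.of (WittVector p k) ⟶ R) (hτ : Spec.map τ = ρ ≫ Z.hom)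
    (G : Z.left.Modules) (N₀ : ModuleCat.{u} R)
    (eG : (Scheme.Modules.restrictFunctor ρ).obj G ≅ tilde N₀) (n : ℕ)
    (hn : IsVectorBundle ((Scheme.Modules.pullback (thickeningι Z (n + 1))).obj G)) :
    Module.Flat (R ⧸ Ideal.span {τ.hom (p : WittVector p k)} ^ (n + 1))
      ((R ⧸ Ideal.span {τ.hom (p : WittVector p k)} ^ (n + 1)) ⊗[R] N₀) := by
  set Iq : Ideal R := Ideal.span {τ.hom (p : WittVector p k)} ^ (n + 1)
  let S : CommRingCat.{u} := CommRingCat.of (R ⧸ Iq)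
  let g : Spec S ⟶ Spec R := Spec.map (CommRingCat.ofHom (algebraMap R S) : R ⟶ S)
  obtain ⟨θ, hθ⟩ := exists_lift_thickening Z ρ τ hτ n
  have h1 : IsFiniteLocallyFree ((Scheme.Modules.pullback θ).obj
      ((Scheme.Modules.pullback (thickeningι Z (n + 1))).obj G)) :=
    (isFiniteLocallyFree_of_isVectorBundle hn).pullback θ
  let e₁ : (Scheme.Modules.pullback θ).obj ((Scheme.Modules.pullback (thickeningι Z (n + 1))).obj G) ≅
      (Scheme.Modules.pullback g).obj (tilde N₀) :=
    (Scheme.Modules.pullbackComp θ (thickeningι Z (n + 1))).app G ≪≫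
      (Scheme.Modules.pullbackCongr hθ).app G ≪≫
      ((Scheme.Modules.pullbackComp g ρ).app G).symm ≪≫
      (Scheme.Modules.pullback g).mapIso
        (((Scheme.Modules.restrictFunctorIsoPullback ρ).app G).symm ≪≫ eG)
  have h2 : IsFiniteLocallyFree ((Scheme.Modules.pullback g).obj (tilde N₀)) :=
    isFiniteLocallyFree_of_iso e₁ h1
  haveI : ((Scheme.Modules.pullback g).obj (tilde N₀)).IsQuasicoherent := by
    haveI := h2.isVectorBundle.isLocallyFree
    infer_instance
  have hfl := flat_sections_of_isFiniteLocallyFree _ h2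
  obtain ⟨e₂⟩ := nonempty_linearEquiv_baseChange_sections (R := R) (S := S) (tilde N₀)
  have h3 := flat_of_linearEquiv' hfl e₂
  have e₃ : (S ⊗[R] N₀) ≃ₗ[S] (S ⊗[R] Γ(tilde N₀, ⊤)) :=
    TensorProduct.AlgebraTensorModule.congr (LinearEquiv.refl S S) (tilde.isoTop N₀).toLinearEquiv
  exact flat_of_linearEquiv' h3 e₃

end Thickening

section PerPoint

open TensorProduct

variable {p : ℕ} [Fact p.Prime] {k : Type u} [Field k] [CharP k p] [PerfectRing k p]
  (Z : SchemeOver (WittVector p k))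

/-- For `ρ : Spec R → 𝒳` with `ρ ≫ 𝒳.hom = Spec τ`, the image of `p` lies in the prime of every point
of `Spec R` over the closed point of `Spec W` (`p` is in the maximal ideal of `W(k)`). -/
theorem map_prime_mem_of_over_closedPoint {R : CommRingCat.{u}}
    (ρ : Spec R ⟶ Z.left) (τ : CommRingCat.of (WittVector p k) ⟶ R) (hτ : Spec.map τ = ρ ≫ Z.hom)
    (q : Spec R) (hq : Z.hom (ρ q) = IsLocalRing.closedPoint (WittVector p k)) :
    τ.hom (p : WittVector p k) ∈ q.asIdeal := by
  have h1 : Spec.map τ q = IsLocalRing.closedPoint (WittVector p k) := by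
    rw [hτ]
    exact hq
  rw [Spec.map_apply] at h1
  have h2 := congrArg PrimeSpectrum.asIdeal h1
  rw [PrimeSpectrum.comap_asIdeal] at h2
  have hp : (p : WittVector p k) ∈ IsLocalRing.maximalIdeal (WittVector p k) := by
    rw [IsLocalRing.mem_maximalIdeal, mem_nonunits_iff]
    intro hu
    have h := hu.map (WittVector.constantCoeff : WittVector p k →+* k)
    rw [constantCoeff_natCast_prime] at h
    exact not_isUnit_zero h
  have h3 : (p : WittVector p k) ∈ Ideal.comap τ.hom q.asIdeal := by
    rw [h2]
    exact hp
  exact Ideal.mem_comap.mp h3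

set_option backward.isDefEq.respectTransparency false in
/-- **The cokernel is free near every point over the closed point of `Spec W`.** -/
theorem exists_openImmersion_chart (hZ : IsProper Z.hom) {V V' : Z.left.Modules} (u : V' ⟶ V)
    (hV : IsVectorBundle V) (hV' : IsVectorBundle V')
    (hn : ∀ n : ℕ, IsVectorBundle ((Scheme.Modules.pullback (thickeningι Z (n + 1))).obj (cokernel u)))
    (x : Z.left) (hx : Z.hom x = IsLocalRing.closedPoint (WittVector p k)) :
    ∃ (Y : Scheme.{u}) (j : Y ⟶ Z.left) (_ : IsOpenImmersion j), x ∈ Set.range j ∧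
      ∃ I : Type u, Finite I ∧
        Nonempty (SheafOfModules.free I ≅ (Scheme.Modules.restrictFunctor j).obj (cokernel u)) := by
  haveI := hZ
  haveI : IsLocallyNoetherian Z.left := LocallyOfFiniteType.isLocallyNoetherian Z.hom
  obtain ⟨U, hU, hxU, I, J, hI, hJ, ⟨eV⟩, ⟨eV'⟩⟩ :=
    exists_affine_trivialisations (isFiniteLocallyFree_of_isVectorBundle hV)
      (isFiniteLocallyFree_of_isVectorBundle hV') x
  let R : CommRingCat.{u} := Γ(Z.left, U)
  haveI : IsNoetherianRing R := IsLocallyNoetherian.component_noetherian ⟨U, hU⟩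
  let ρ : Spec R ⟶ Z.left := hU.fromSpec
  obtain ⟨φ₀, ⟨eG⟩⟩ := exists_tilde_iso_restrict_cokernel u hU eV eV'
  let N₀T : Type u := (I →₀ (R : Type u)) ⧸ LinearMap.range φ₀.hom
  let N₀ : ModuleCat.{u} R := ModuleCat.of R N₀T
  haveI : Module.Finite R N₀T := inferInstance
  haveI : Module.FinitePresentation R N₀T := Module.finitePresentation_of_finite R N₀T
  let τ : CommRingCat.of (WittVector p k) ⟶ R := Spec.preimage (ρ ≫ Z.hom)
  have hτ : Spec.map τ = ρ ≫ Z.hom := Spec.map_preimage _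
  have hflat : ∀ n : ℕ, Module.Flat ((R : Type u) ⧸ Ideal.span {τ.hom (p : WittVector p k)} ^ (n + 1))
      (((R : Type u) ⧸ Ideal.span {τ.hom (p : WittVector p k)} ^ (n + 1)) ⊗[R] N₀T) := fun n =>
    flat_quotient_pow_of_isVectorBundle_pullback Z ρ τ hτ (cokernel u) N₀ eG n (hn n)
  let q : Spec R := hU.primeIdealOf ⟨x, hxU⟩
  have hq : ρ q = x := hU.fromSpec_primeIdealOf ⟨x, hxU⟩
  have hπq : τ.hom (p : WittVector p k) ∈ q.asIdeal :=
    map_prime_mem_of_over_closedPoint Z ρ τ hτ q (by rw [hq]; exact hx)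
  obtain ⟨r, hr, hfree⟩ :=
    exists_free_localizedModule_of_flat_quotient_powers (τ.hom (p : WittVector p k)) N₀T hflat
      q.asIdeal hπq
  let Rr : CommRingCat.{u} := CommRingCat.of (Localization.Away r)
  obtain ⟨I', hI', ⟨eF⟩⟩ := exists_free_iso_restrict_away (R := R) (Rr := Rr) r N₀ hfree
  let j₀ : Spec Rr ⟶ Spec R := Spec.map (CommRingCat.ofHom (algebraMap R Rr) : R ⟶ Rr)
  refine ⟨Spec Rr, j₀ ≫ ρ, inferInstance, ?_, I', hI', ⟨?_⟩⟩
  · obtain ⟨y, hy⟩ : q ∈ Set.range (PrimeSpectrum.comap (algebraMap R (Localization.Away r))) := by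
      rw [PrimeSpectrum.localization_away_comap_range (Localization.Away r) r]
      exact hr
    refine ⟨y, ?_⟩
    rw [Scheme.Hom.comp_apply, ← hq]
    exact congrArg (fun t => ρ t) hy
  · exact eF ≪≫ (Scheme.Modules.restrictFunctor j₀).mapIso eG.symm ≪≫
      ((Scheme.Modules.restrictFunctorComp j₀ ρ).app (cokernel u)).symm

/-- **Görtz–Wedhorn II, Prop. 24.95 with Lemma 24.96 for the cokernel of a map of vector bundles.** -/
theorem isVectorBundle_cokernel_of_thickenings (hZ : IsProper Z.hom) {V V' : Z.left.Modules}
    (u : V' ⟶ V) (hV : IsVectorBundle V) (hV' : IsVectorBundle V')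
    (hn : ∀ n : ℕ, IsVectorBundle ((Scheme.Modules.pullback (thickeningι Z (n + 1))).obj (cokernel u))) :
    IsVectorBundle (cokernel u) := by
  haveI := hZ
  let P : Z.left → Prop := fun x => ∃ (Y : Scheme.{u}) (j : Y ⟶ Z.left) (_ : IsOpenImmersion j),
    x ∈ Set.range j ∧ ∃ I : Type u, Finite I ∧
      Nonempty (SheafOfModules.free I ≅ (Scheme.Modules.restrictFunctor j).obj (cokernel u))
  have hopen : IsOpen {x | P x} := by
    rw [isOpen_iff_forall_mem_open]
    rintro x ⟨Y, j, hj, hx, I, hI, e⟩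
    exact ⟨Set.range j, fun y hy => ⟨Y, j, hj, hy, I, hI, e⟩, j.isOpenEmbedding.isOpen_range, hx⟩
  let U : Z.left.Opens := ⟨{x | P x}, hopen⟩
  have hU : U = ⊤ :=
    opens_eq_top_of_isClosedMap Z.hom Z.hom.isClosedMap (IsLocalRing.closedPoint _)
      (fun y => IsLocalRing.specializes_closedPoint y) U
      (fun x hx => exists_openImmersion_chart Z hZ u hV hV' hn x hx)
  have hall : ∀ x, P x := fun x => show x ∈ U by rw [hU]; trivial
  exact (isFiniteLocallyFree_of_openImmersion_charts hall).isVectorBundle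

end PerPoint

end FFC

/-- **STUB ED · `stub_formallyFreeCokernel`** of line `chow-zariski-pushforward` (registered
signature, universe `0`): a formally locally free cokernel of a map of vector bundles on a proper
`W(k)`-scheme is locally free (Görtz–Wedhorn II, Prop. 24.95 / Lemma 24.96). -/
theorem stub_formallyFreeCokernel :
    ∀ (p : ℕ) [Fact p.Prime] (k : Type) [Field k] [CharP k p] [PerfectRing k p]
      (Z : SchemeOver (WittVector p k)), IsProper Z.hom →
      ∀ (V V' : Z.left.Modules) (u : V' ⟶ V), IsVectorBundle V → IsVectorBundle V' →
        (∀ n : ℕ, IsVectorBundle ((Scheme.Modules.pullback (thickeningι Z (n + 1))).obj (cokernel u))) →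
        IsVectorBundle (cokernel u) :=
  fun _ _ _ _ _ _ Z hZ _ _ u hV hV' hn => FFC.isVectorBundle_cokernel_of_thickenings Z hZ u hV hV' hn

end Summit.HodgeConjecture.HodgeConjecture.Theorems.FormalVectorBundlesAlgebraize

end
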